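import Literature.AlgebraicGeometry.Limits.LocalizationProdLimit
import Literature.AlgebraicGeometry.Morphisms.SmoothConnectedFibreLocusRepresents
import HarnessLib

/-!
# Limits of schemes, RELATIVE over `P`: smooth geometrically connected fibres over `P ×_A Spec A_S` ⇒ over `P ×_A D(s)` for some stage
# ([MFK] Prop. 7.3 step (I); [EGA IV₃] 12.2.4; [Stacks] Tag 01Z3)

Topic `Literature/AlgebraicGeometry/Limits`; namespace `Literature.AlgebraicGeometry.Limits.LocApprox` (continues ★ `LocalizationDiagram`, ★
`LocalizationProdLimit` `P ×_A Spec A_S = lim_s P ×_A D(s)`, ★ `LocalizationRelativeSmoothSpread` (b)).  THEOREMS ONLY (no definition, no named fact,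
no `instance`, no notation, no `sorry`).  Cell `hodgecm-mathlib` (D-0151), FLOOR 0, P6 «MOD programme», SPREAD door of `stub_RGD` (LEAD M-17m), organ
(α) SP1 «ABELIAN-SCHEME SPREAD OVER A LocApprox STAGE», FILE **(f) «RELATIVE GEOMETRICALLY-CONNECTED-FIBRE SPREAD»** (A-p06 (g31) skeleton v1
`stub_exists_stage_geometricallyConnected`, 2026-09-01 20:55:35Z; hand A-p14 (g33) per 21:00:13Z).  `--supports stmt-HodgeConjecture-24832`, count-neutral:
HC_CM is proved only modulo the 2 remaining named inputs (hLiu418 24832, h413 24833) until rung 0 closes; nothing here is about HC.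

SETTING (★ currency): `A` a ring, `S ⊆ A` a submonoid, `B = A_S`; `P → Spec A` quasi-compact; the STAGES `P ⊗ D(t)` (`(baseDiagram S).obj t`), the
GENERIC FIBRE `P ⊗ specOver A B` with cone legs `P ◁ (baseCone S B).π.app t` and transitions `P ◁ (baseDiagram S).map ρ` (`ρ : s ⟶ t`); a proper
smooth `P ⊗ D(t)`-scheme `Y` (any `Y : Over (P ⊗ D(t)).left`), its generic fibre `pullback.snd Y.hom (P ◁ (baseCone S B).π.app t).left` and its
restrictions `pullback.snd Y.hom (P ◁ (baseDiagram S).map ρ).left`.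

THE MATHEMATICS ([MumfordFogartyKirwan1994] Ch. 7 §2, Prop. 7.3, proof, step (I) pp. 132–133: for `p : X → S` proper flat over a locally noetherian `S`
the set `U₁ = {s | X_s smooth and geometrically connected}` is OPEN — ★ `isOpen_setOf_smooth_and_geometricallyConnected_fiber` ([EGAIV3] 12.2.4);
and a base change `X ×_S T → T` is smooth with geometrically connected fibres iff `T → S` lands in `U₁` — ★
`range_subset_setOf_iff_smooth_and_geometricallyConnected`; [StacksProject] Tag 01Z3: an open of a stage containing the image of the limit of
quasi-compact schemes with affine transitions contains the image of some stage — Mathlib `exists_map_eq_top` on ★ `isLimitProdCone S B P`).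
(1) BASE LOCUS LEMMA: an open `U ⊆ P ⊗ D(t)` containing the image of the generic fibre `P ⊗ Spec A_S` contains the image of some `P ⊗ D(s)`, `s ≤ t`
(★ SP2 FILE 1 §4 pattern, here once for any open).  (2) With `U := U₁(Y → P ⊗ D(t))`: the generic fibre of `Y` smooth and geometrically connected
⇒ `π_t` lands in `U₁` ⇒ some transition `P ⊗ D(s) → P ⊗ D(t)` lands in `U₁` ⇒ the restriction `Y ×_{P⊗D(t)} (P ⊗ D(s)) → P ⊗ D(s)` is smooth with
geometrically connected fibres.  UNIVERSE: step (2) is stated at `Scheme.{0}` because the ★ locus theorem (its `h⁰`-semicontinuity chain ★ U2b∕U4) is;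
step (1) is universe-polymorphic.

* §1 (any universe) **`exists_stage_range_whiskerLeft_map_subset`** — the BASE LOCUS LEMMA;
* §2 (`Scheme.{0}`) `isLocallyNoetherian_tensorObj_baseDiagram_left` (`P ⊗ D(t)` is locally noetherian for `A` noetherian, `P` locally of finite type),
  **`exists_stage_smooth_and_geometricallyConnected`**, HEAD **`exists_stage_geometricallyConnected`** (= skeleton socket (f) with the two riders
  `[IsLocallyNoetherian (P ⊗ D(t)).left]`, universe 0).

## References
* [MumfordFogartyKirwan1994] D. Mumford, J. Fogarty, F. Kirwan, *Geometric Invariant Theory*, 3rd ed. (1994), Ch. 7 §2, Prop. 7.3, proof, step (I)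
  (pp. 132–133).
* [EGAIV3] A. Grothendieck, J. Dieudonné, EGA IV₃ (Publ. Math. IHÉS 28, 1966), Thm. 12.2.4.
* [StacksProject] The Stacks Project, Tag 01Z3 (opens in limits of schemes), Tag 01ZC.
* [GortzWedhorn2020] U. Görtz, T. Wedhorn, *Algebraic Geometry I*, 2nd ed. (2020), §(10.13) pp. 261–262.
-/

set_option autoImplicit false

noncomputable section

universe u

open CategoryTheory CategoryTheory.Limits AlgebraicGeometry TopologicalSpace MonoidalCategory CartesianMonoidalCategory
open Opposite

namespace Literature.AlgebraicGeometry.Limits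

namespace LocApprox

open Literature.AlgebraicGeometry.Motives (SchemeOver specOver)
open Literature.AlgebraicGeometry.Morphisms (range_subset_setOf_iff_smooth_and_geometricallyConnected
  isOpen_setOf_smooth_and_geometricallyConnected_fiber)

set_option backward.isDefEq.respectTransparency false

/-! ## §1 The BASE locus lemma: an open of a stage containing the generic fibre contains a finer stage -/

section Base

variable {A : Type u} [CommRing A] {S : Submonoid A} {B : Type u} [CommRing B] [Algebra A B] [IsLocalization S B]

/-- **BASE LOCUS LEMMA** (Stacks 01Z3 on `P ×_A Spec A_S = lim_s P ×_A D(s)`): for `P → Spec A` quasi-compact and an open `U ⊆ P ⊗ D(t)` containing the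
image of the generic fibre `π_t : P ⊗ Spec A_S → P ⊗ D(t)`, some transition `P ⊗ D(s) → P ⊗ D(t)`, `s ≤ t`, lands in `U` (Mathlib `exists_map_eq_top` on
★ `isLimitProdCone S B P`; ★ SP2 `LevelStructureSpreadStages` §4 is the special case of the injectivity locus).
[cite: StacksProject, Tag 01Z3] [cite: GortzWedhorn2020, §(10.13) (pp. 261–262)] -/
theorem exists_stage_range_whiskerLeft_map_subset (P : SchemeOver A) [QuasiCompact P.hom] {t : Idx S}
    (U : (P ⊗ (baseDiagram S).obj t).left.Opens) (hU : Set.range (P ◁ (baseCone S B).π.app t).left ⊆ (U : Set (P ⊗ (baseDiagram S).obj t).left)) :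
    ∃ (s : Idx S) (ρ : s ⟶ t), Set.range (P ◁ (baseDiagram S).map ρ).left ⊆ (U : Set (P ⊗ (baseDiagram S).obj t).left) := by
  have hU' : (prodCone S B P).π.app t ⁻¹ᵁ U = ⊤ := by
    rw [prodCone_π_app]
    ext y
    simp only [TopologicalSpace.Opens.map_coe, Set.mem_preimage, TopologicalSpace.Opens.coe_top, Set.mem_univ, iff_true]
    exact hU ⟨y, rfl⟩
  obtain ⟨s, ρ, hs⟩ := exists_map_eq_top (prodDiagram S P) (prodCone S B P) (isLimitProdCone S B P) U hU'
  refine ⟨s, ρ, ?_⟩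
  rintro _ ⟨y, rfl⟩
  have hy : y ∈ (((prodDiagram S P).map ρ ⁻¹ᵁ U : ((prodDiagram S P).obj s).Opens) : Set ((prodDiagram S P).obj s)) := by
    rw [hs]; trivial
  exact hy

end Base

/-! ## §2 Smooth geometrically connected fibres spread to a stage (`Scheme.{0}`: the ★ locus theorem is universe-0) -/

section Fibres

variable {A : Type} [CommRing A] {S : Submonoid A} {B : Type} [CommRing B] [Algebra A B] [IsLocalization S B]

/-- `P ⊗ D(t)` is locally noetherian when `A` is noetherian and `P → Spec A` is locally of finite type (Mathlib `LocallyOfFiniteType.isLocallyNoetherian`).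
[cite: GortzWedhorn2020, §(10.13) (pp. 261–262)] -/
theorem isLocallyNoetherian_tensorObj_baseDiagram_left [IsNoetherianRing A] (P : SchemeOver A) [LocallyOfFiniteType P.hom] (t : Idx S) :
    IsLocallyNoetherian (P ⊗ (baseDiagram S).obj t).left := by
  haveI : LocallyOfFiniteType (P ⊗ (baseDiagram S).obj t).hom := by
    rw [Over.tensorObj_hom]
    infer_instance
  haveI : IsLocallyNoetherian (Spec (CommRingCat.of A)) := inferInstance
  exact LocallyOfFiniteType.isLocallyNoetherian (P ⊗ (baseDiagram S).obj t).hom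

/-- **SMOOTH GEOMETRICALLY CONNECTED FIBRES SPREAD FROM `P_B` TO A STAGE `P_s`** ([MumfordFogartyKirwan1994] Prop. 7.3 step (I) + Stacks 01Z3): let
`P → Spec A` be quasi-compact, `Y → P ⊗ D(t)` proper and flat, locally of finite presentation, `P ⊗ D(t)` locally noetherian, and suppose the generic fibre
`Y ×_{P⊗D(t)} (P ⊗ Spec A_S) → P ⊗ Spec A_S` is smooth and geometrically connected.  Then for some stage `s ≤ t` the restriction
`Y ×_{P⊗D(t)} (P ⊗ D(s)) → P ⊗ D(s)` is smooth and geometrically connected: `π_t` lands in the open `U₁(Y → P ⊗ D(t))` (★ range criterion + ★ openness),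
hence so does some transition (§1), hence the restriction (★ range criterion again).
[cite: MumfordFogartyKirwan1994, Ch. 7 §2, Prop. 7.3, proof, step (I) (pp. 132–133)] [cite: EGAIV3, Thm. 12.2.4] [cite: StacksProject, Tag 01Z3] -/
theorem exists_stage_smooth_and_geometricallyConnected (P : SchemeOver A) [QuasiCompact P.hom] {t : Idx S} (Y : Over (P ⊗ (baseDiagram S).obj t).left)
    [IsProper Y.hom] [Flat Y.hom] [LocallyOfFinitePresentation Y.hom] [IsLocallyNoetherian (P ⊗ (baseDiagram S).obj t).left]
    (hsm : Smooth (pullback.snd Y.hom (P ◁ (baseCone S B).π.app t).left))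
    (hgc : GeometricallyConnected (pullback.snd Y.hom (P ◁ (baseCone S B).π.app t).left)) :
    ∃ (s : Idx S) (ρ : s ⟶ t), Smooth (pullback.snd Y.hom (P ◁ (baseDiagram S).map ρ).left) ∧
      GeometricallyConnected (pullback.snd Y.hom (P ◁ (baseDiagram S).map ρ).left) := by
  -- the open `U₁` of smooth geometrically connected fibres of `Y → P ⊗ D(t)`
  let U : (P ⊗ (baseDiagram S).obj t).left.Opens :=
    ⟨{z | Smooth (Y.hom.fiberToSpecResidueField z) ∧ GeometricallyConnected (Y.hom.fiberToSpecResidueField z)},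
      isOpen_setOf_smooth_and_geometricallyConnected_fiber Y.hom⟩
  -- the generic fibre is smooth and geometrically connected ⇒ `π_t` lands in `U₁`
  have hU : Set.range (P ◁ (baseCone S B).π.app t).left ⊆ (U : Set (P ⊗ (baseDiagram S).obj t).left) :=
    (range_subset_setOf_iff_smooth_and_geometricallyConnected
      (IsPullback.of_hasPullback Y.hom (P ◁ (baseCone S B).π.app t).left)).mpr ⟨hsm, hgc⟩
  obtain ⟨s, ρ, hs⟩ := exists_stage_range_whiskerLeft_map_subset P U hU
  exact ⟨s, ρ, (range_subset_setOf_iff_smooth_and_geometricallyConnected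
    (IsPullback.of_hasPullback Y.hom (P ◁ (baseDiagram S).map ρ).left)).mp hs⟩

/-- **RELATIVE GEOMETRICALLY-CONNECTED-FIBRE SPREAD OVER A LocApprox STAGE** (= A-p06 (g31) skeleton v1 socket (f) `stub_exists_stage_geometricallyConnected`,
with the riders `[IsLocallyNoetherian (P ⊗ D(t)).left]` and universe 0): for `P → Spec A` quasi-compact and `Y → P ⊗ D(t)` smooth and proper over a locally
noetherian `P ⊗ D(t)`, if the generic fibre `Y ×_{P⊗D(t)} (P ⊗ Spec A_S) → P ⊗ Spec A_S` is geometrically connected then so is the restriction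
`Y ×_{P⊗D(t)} (P ⊗ D(s)) → P ⊗ D(s)` for some stage `s ≤ t`. [cite: MumfordFogartyKirwan1994, Ch. 7 §2, Prop. 7.3, proof, step (I) (pp. 132–133)]
[cite: EGAIV3, Thm. 12.2.4] [cite: StacksProject, Tag 01Z3] -/
theorem exists_stage_geometricallyConnected (P : SchemeOver A) [QuasiCompact P.hom] {t : Idx S} (Y : Over (P ⊗ (baseDiagram S).obj t).left)
    [Smooth Y.hom] [IsProper Y.hom] [IsLocallyNoetherian (P ⊗ (baseDiagram S).obj t).left]
    (h : GeometricallyConnected (pullback.snd Y.hom (P ◁ (baseCone S B).π.app t).left)) :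
    ∃ (s : Idx S) (ρ : s ⟶ t), GeometricallyConnected (pullback.snd Y.hom (P ◁ (baseDiagram S).map ρ).left) := by
  obtain ⟨s, ρ, -, hs⟩ := exists_stage_smooth_and_geometricallyConnected P Y
    (MorphismProperty.pullback_snd _ _ inferInstance) h
  exact ⟨s, ρ, hs⟩

end Fibres

end LocApprox

end Literature.AlgebraicGeometry.Limits

end
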